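import Literature.MathematicalPhysics.QuantumFieldTheory.Balaban1983to89.B4Cor23ZeroTorus
import Literature.MathematicalPhysics.QuantumFieldTheory.Balaban1983to89.B4ThmZeroTorusEta
import Literature.MathematicalPhysics.QuantumFieldTheory.Balaban1983to89.Step

/-!
# `Balaban1983to89.B4Cor23ZeroTorusEta` — T. Bałaban, *Regularity and decay of lattice Green's functions*, Commun. Math. Phys. **89** (1983)
# 571–597 [Balaban1983RegularityDecay]: the typed statement `B4.Cor23Printed` (Corollary 2.3 (2.30) pp. 580–581, all four pairings and the
# `δG_k(Ω,Ω₀,A)` clause) HOLDS for the ZERO-FIELD TORUS FAMILY `B4ThmZeroTorusEta.torusEtaFam` of Bałaban's concrete scalar tower — every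
# volume, every mass `m² ≥ 0`, `Ω = Ω₀ = T_η`

statement-level skeleton of published theorems with citation tags; proofs where landed; nothing here is a claim about the Yang–Mills mass gap

PDF held: `paper:balaban1983-cmp89-regularity-decay` (journal page = PDF page + 570), p. 580 [PDF 10] (Cor. 2.3 (2.30)), p. 581 [PDF 11] (the
`δG`-clause), p. 572 [PDF 2] (the torus); read by this seat.

CITATION HEADER (lean-in-tree rule).  Cell `lit-balaban` (HOME `run/shared/lean/pub/lit-balaban/`), Phase-2 proof seat **p14** gen 10 (unit
`lit-balaban-p14`); SKELETON row **B4.Cor2.3** (decl of record `B4.Cor23Printed`, owner r01): its ZERO-FIELD TORUS FAMILY, in the SAME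
`B4.EtaSetting` currency in which p38 booked the Theorem p. 573 (`B4ThmZeroTorusEta.thmPrintedNN_torusEtaFam`); sibling of b04's
`B4Cor23ZeroEta.cor23Printed_zeroField` (the family of Neumann REGIONS in `ℤ^{d+1}`).  USED BY NAME, never restated: p38's carrier
`B4ThmZeroTorusEta.{TorusEtaIdx, torusEtaFam, pairOps, infTS, diamT, T_le_diamT}` (whose `pair`/`dpair`/`ssdist`/`l2Norm` fields ARE the
four pairings of (2.30), the support distance and the `L²` norms (1.5)), this seat's `B4Cor23ZeroTorus.cor23_zero_torus` (the four pairings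
with explicit `δ₀, c₀`), `B5Display136Torus.G_eq_smul_Grs`, `B5CombesThomasTorus.{nsq, nsq_eq_dot}`, `B5Ineq137Torus.{distX, T}`.

WHAT IS PRINTED (verbatim).  p. 580 [PDF 10]: *"Corollary 2.3. If Ω and A are as in Proposition I.2.1, then there exist positive constants c₀,
δ₀ such that for arbitrary scalar field configurations f, f′ defined on Ω, we have |⟨f, G_k(Ω,A)f′⟩|, |⟨f, D^η_{A,μ}G_k(Ω,A)f′⟩|,
|⟨f, G_k(Ω,A)D^{η*}_{A,ν}f′⟩|, |⟨f, D^η_{A,μ}G_k(Ω,A)D^{η*}_{A,ν}f′⟩| ≤ c₀e^{−δ₀dist(supp f, supp f′)}‖f‖₂‖f′‖₂. (2.30)"*; p. 581 [PDF 11]: *"The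
same inequalities hold for δG_k(Ω,Ω₀,A) with the additional factor e^{−δ₀(dist(supp f, Ωᶜ) + dist(supp f′, Ωᶜ))}."*; p. 572 [PDF 2]: *"Another
common case is to consider operators on subsets of a torus T_η which we identify with a rectangular parallelepiped in ηZ^d with periodic
conditions."*

WHAT THIS FILE PROVES (kernel-checked, zero `sorry`, theorems only; axioms standard).
* §1 bookkeeping on p38's carrier: `infTS_le` (`dist_T(supp f, supp f′) ≤ |z − z′|_T` on the supports), `G_top_eq_Grs`
  (`G_K = G_K^{resc}` at the top level; `ε = L^{−K}` is `Step.eps_eq_inv_pow`), `pairOps_zero_mulVec` (the four operators of `δG_k = G_k − G_k = 0` vanish).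
* §2 **`cor23Printed_torusEtaFam`** — for `L > 1`, `a > 0`, `m² ≥ 0` and every `d`: `B4.Cor23Printed (torusEtaFam d L a m²)` — the typed
  Corollary 2.3 for the family of ALL zero-field torus instances `(P = (d, L, m, K), K ≥ 1, e)` of the concrete scalar tower: one pair
  `c₀, δ₀` (from `cor23_zero_torus`, functions of `d, L, a`), any `e₁` (the charge is idle at `A = 0`), all four pairings `pair n`
  (`n = 0,…,3`: `G_k`, `∂_μG_k`, `G_k∂*_ν`, `∂_μG_k∂*_ν` componentwise on `f : T_η → R^d`, Cauchy–Schwarz over the components) and the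
  `δG`-clause `dpair n` (trivially: `Ω = Ω₀`, `δG_k = 0`, `bdistS = 0`).
HONEST SCOPE.  `A = 0`, `U ≡ 1`, `Ω = Ω₀ = T_η` (so the `δG`-clause carries no information here); the instance level is the top level `k = K`
of each volume (lower levels are top levels of other volumes of the family); `N = d` components as in p38's carrier; sup torus metric in
`η`-units (`ssdist = ε·dist_T`); constants existential (explicit in `B4Cor23ZeroTorus`); method = torus Combes–Thomas (files 1–2 of the gen),
not the print's random walk; nothing here is summit progress.
-/

namespace Literature.MathematicalPhysics.QuantumFieldTheory.Balaban1983to89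

open Matrix Finset

noncomputable section

namespace B4Cor23ZeroTorusEta

open B1RG242Torus B5Display136Torus B5Ineq137Torus B5CombesThomasTorus B4ThmZeroTorusEta B4Cor23ZeroTorus

variable {P : Params} {N : ℕ}

/-! ## §1 Bookkeeping on the zero-field torus carrier -/

/-- `dist_T(supp f, supp f′) ≤ |z − z′|_T` for `z ∈ supp f_n`, `z′ ∈ supp f′_{n′}`. [cite: Balaban1983RegularityDecay, Cor. 2.3 p.581
(«dist(supp f, supp f′)»); bookkeeping] -/
theorem infTS_le {f f' : Fin N → Site P 0 → ℝ} {n n' : Fin N} {z z' : Site P 0} (hz : f n z ≠ 0) (hz' : f' n' z' ≠ 0) :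
    infTS P f f' ≤ T P 0 z z' := by
  unfold infTS
  refine csInf_le ⟨0, fun t ht => ?_⟩ (Set.mem_insert_of_mem _ ⟨(z, z'), ⟨⟨n, hz⟩, ⟨n', hz'⟩⟩, rfl⟩)
  rcases Set.mem_insert_iff.mp ht with rfl | ⟨p, _, rfl⟩
  · exact diamT_nonneg P
  · exact T_nonneg P 0 p.1 p.2

/-- At the top level the tower's `G_K` IS the rescaled operator (2.22): `G_K = (L^Kε)²G_K^{resc} = G_K^{resc}` (`L^Kε = 1`).
[cite: Balaban1982Higgs1, (2.22) p.610] -/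
theorem G_top_eq_Grs {a msq : ℝ} (ha : 0 < a) (hm : 0 ≤ msq) (hK : 1 ≤ P.K) :
    (tower P a msq).G P.K = Grs P a msq P.K := by
  rw [G_eq_smul_Grs (P := P) ha hm hK, P.spacing_K, one_pow, one_smul]

/-- On the whole torus `δG_k(Ω,Ω₀,0) = G_k − G_k = 0`, and all four operators of (2.30) built on `0` act by zero.
[cite: Balaban1983RegularityDecay, (1.11) p.573, Cor. 2.3 p.581 (the δG-clause)] -/
theorem pairOps_zero_mulVec (s : ℝ) (μ ν : Fin P.d) (n : Fin 4) (g : Site P 0 → ℝ) :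
    pairOps P s (0 : Matrix (Site P 0) (Site P 0) ℝ) μ ν n *ᵥ g = 0 := by
  fin_cases n <;> simp [pairOps]

/-- Cauchy–Schwarz bookkeeping: termwise `|t_m| ≤ B√a_m√b_m` gives `|Σt_m| ≤ B√(Σa)√(Σb)`. [folklore] -/
private theorem abs_sum_le {ι : Type*} [Fintype ι] (t a b : ι → ℝ) {B : ℝ} (hB : 0 ≤ B) (ha : ∀ j, 0 ≤ a j) (hb : ∀ j, 0 ≤ b j)
    (h : ∀ j, |t j| ≤ B * Real.sqrt (a j) * Real.sqrt (b j)) :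
    |∑ j, t j| ≤ B * Real.sqrt (∑ j, a j) * Real.sqrt (∑ j, b j) := by
  calc |∑ j, t j| ≤ ∑ j, |t j| := Finset.abs_sum_le_sum_abs _ _
    _ ≤ ∑ j, B * Real.sqrt (a j) * Real.sqrt (b j) := Finset.sum_le_sum fun j _ => h j
    _ = B * ∑ j, Real.sqrt (a j) * Real.sqrt (b j) := by
        rw [Finset.mul_sum]
        exact Finset.sum_congr rfl fun j _ => by ring
    _ ≤ B * (Real.sqrt (∑ j, a j) * Real.sqrt (∑ j, b j)) :=
        mul_le_mul_of_nonneg_left (Real.sum_sqrt_mul_sqrt_le _ ha hb) hB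
    _ = B * Real.sqrt (∑ j, a j) * Real.sqrt (∑ j, b j) := by ring

/-- `√(EA)·√(EB) = E·√A·√B` for `E ≥ 0` (the weight `ε^d` of the `L²` norms (1.5)). [folklore] -/
private theorem sqrt_weight {E A B : ℝ} (hE : 0 ≤ E) :
    Real.sqrt (E * A) * Real.sqrt (E * B) = E * (Real.sqrt A * Real.sqrt B) := by
  rw [Real.sqrt_mul hE, Real.sqrt_mul hE]
  have h := Real.mul_self_sqrt hE
  calc Real.sqrt E * Real.sqrt A * (Real.sqrt E * Real.sqrt B) = (Real.sqrt E * Real.sqrt E) * (Real.sqrt A * Real.sqrt B) := by ring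
    _ = E * (Real.sqrt A * Real.sqrt B) := by rw [h]

/-! ## §2 `B4.Cor23Printed` for the zero-field torus family -/

/-- **COROLLARY 2.3 — THE TYPED STATEMENT `B4.Cor23Printed` HOLDS FOR THE ZERO-FIELD TORUS FAMILY** of Bałaban's concrete scalar tower:
for `L > 1`, `a > 0`, `m² ≥ 0` and every `d`, `Cor23Printed (torusEtaFam d L a m²)` — one pair `c₀, δ₀` for ALL volumes `(d, L, m, K)`,
`K ≥ 1` (instance `k = K`, `η = L^{−K}`, `Ω = Ω₀ = T_η`, `A = 0`, every charge `e`, any threshold `e₁`): the four pairings `|⟨f, G_kf′⟩|`,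
`|⟨f, ∂^η_μG_kf′⟩|`, `|⟨f, G_k∂^{η*}_νf′⟩|`, `|⟨f, ∂^η_μG_k∂^{η*}_νf′⟩| ≤ c₀e^{−δ₀·ε·dist_T(supp f, supp f′)}‖f‖₂‖f′‖₂` for `f, f′ : T_η → R^d`
(`B4Cor23ZeroTorus.cor23_zero_torus` componentwise + Cauchy–Schwarz), and the `δG_k(Ω,Ω₀,0)`-clause (trivial on the whole torus: `δG_k = 0`).
[cite: Balaban1983RegularityDecay, Cor. 2.3 (2.30) pp.580–581] -/
theorem cor23Printed_torusEtaFam (d L : ℕ) (hL : 1 < L) {a : ℝ} (ha : 0 < a) {msq : ℝ} (hmsq : 0 ≤ msq) :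
    B4.Cor23Printed (torusEtaFam d L a msq) := by
  obtain ⟨δ₀, c₀, hδ₀, hc₀, h⟩ := cor23_zero_torus d L hL ha
  refine ⟨c₀, δ₀, 1, hc₀, hδ₀, one_pos, ?_⟩
  intro i _ _ _ _ n μ ν f f'
  change Fin i.P.d at μ ν
  change Fin i.P.d → Site i.P 0 → ℝ at f f'
  -- the member: volume `P = i.P`, level `K`, `ε = L^{−K}`
  have hK1 : 1 ≤ i.P.K := i.hK
  have hKm : i.P.K ≤ i.P.m + i.P.K := Nat.le_add_left _ _
  have hε0 : 0 ≤ i.P.eps ^ i.P.d := pow_nonneg i.P.eps_pos.le _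
  have hG : (tower i.P a msq).G i.P.K = Grs i.P a msq i.P.K := G_top_eq_Grs ha hmsq hK1
  have hε : i.P.eps = ((i.P.L : ℝ) ^ i.P.K)⁻¹ := Step.eps_eq_inv_pow i.P
  set r := i.P.eps * infTS i.P f f' with hr
  -- the separation of the supports, component by component, in `η`-units
  have hsep : ∀ (m : Fin i.P.d) (x x' : Site i.P 0), f m x ≠ 0 → f' m x' ≠ 0 → r ≤ distX i.P i.P.K x x' := by
    intro m x x' hx hx'
    unfold distX
    rw [hr, Step.eps_eq_inv_pow]
    exact mul_le_mul_of_nonneg_left (infTS_le hx hx') (inv_nonneg.mpr (pow_pos i.P.cast_L_pos _).le)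
  have hall := fun m : Fin i.P.d => h i.P i.hPd i.hPL msq hmsq i.P.K hK1 hKm μ ν (f m) (f' m) r (hsep m)
  have hB0 : 0 ≤ c₀ * Real.exp (-(δ₀ * r)) := by positivity
  -- the `n`-th operator of (2.30), componentwise
  have hterm : ∀ m : Fin i.P.d,
      |f m ⬝ᵥ (pairOps i.P i.P.eps ((tower i.P a msq).G i.P.K) μ ν n *ᵥ f' m)|
        ≤ c₀ * Real.exp (-(δ₀ * r)) * Real.sqrt (nsq i.P (f m)) * Real.sqrt (nsq i.P (f' m)) := by
    intro m
    obtain ⟨h0, h1, h2, h3⟩ := hall m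
    rw [hG, hε]
    fin_cases n
    · simpa [pairOps] using h0
    · simpa [pairOps] using h1
    · simpa [pairOps] using h2
    · simpa [pairOps, Matrix.mul_assoc] using h3
  have hsum := abs_sum_le _ _ _ hB0 (fun m => nsq_nonneg _) (fun m => nsq_nonneg _) hterm
  have hnsq : ∀ g : Fin i.P.d → Site i.P 0 → ℝ, ∑ m, nsq i.P (g m) = ∑ m, g m ⬝ᵥ g m :=
    fun g => Finset.sum_congr rfl fun m _ => nsq_eq_dot (g m)
  rw [hnsq f, hnsq f'] at hsum
  constructor
  · -- the pairing clause
    show i.P.eps ^ i.P.d * |∑ m, f m ⬝ᵥ (pairOps i.P i.P.eps ((tower i.P a msq).G i.P.K) μ ν n *ᵥ f' m)|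
        ≤ c₀ * Real.exp (-(δ₀ * (i.P.eps * infTS i.P f f'))) * Real.sqrt (i.P.eps ^ i.P.d * ∑ m, f m ⬝ᵥ f m) *
          Real.sqrt (i.P.eps ^ i.P.d * ∑ m, f' m ⬝ᵥ f' m)
    rw [← hr, mul_assoc (c₀ * Real.exp (-(δ₀ * r))), sqrt_weight hε0]
    calc i.P.eps ^ i.P.d * |∑ m, f m ⬝ᵥ (pairOps i.P i.P.eps ((tower i.P a msq).G i.P.K) μ ν n *ᵥ f' m)|
        ≤ i.P.eps ^ i.P.d * (c₀ * Real.exp (-(δ₀ * r)) * Real.sqrt (∑ m, f m ⬝ᵥ f m) * Real.sqrt (∑ m, f' m ⬝ᵥ f' m)) :=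
          mul_le_mul_of_nonneg_left hsum hε0
      _ = c₀ * Real.exp (-(δ₀ * r)) * (i.P.eps ^ i.P.d * (Real.sqrt (∑ m, f m ⬝ᵥ f m) * Real.sqrt (∑ m, f' m ⬝ᵥ f' m))) := by
          ring
  · -- the `δG`-clause: `δG_k(T_η, T_η, 0) = 0`
    show i.P.eps ^ i.P.d * |∑ m, f m ⬝ᵥ (pairOps i.P i.P.eps ((tower i.P a msq).G i.P.K - (tower i.P a msq).G i.P.K) μ ν n *ᵥ f' m)|
        ≤ c₀ * Real.exp (-(δ₀ * (i.P.eps * infTS i.P f f'))) * Real.exp (-(δ₀ * ((0 : ℝ) + 0))) *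
          Real.sqrt (i.P.eps ^ i.P.d * ∑ m, f m ⬝ᵥ f m) * Real.sqrt (i.P.eps ^ i.P.d * ∑ m, f' m ⬝ᵥ f' m)
    rw [sub_self]
    simp only [pairOps_zero_mulVec, dotProduct_zero, Finset.sum_const_zero, abs_zero, mul_zero]
    positivity

end B4Cor23ZeroTorusEta

end

end Literature.MathematicalPhysics.QuantumFieldTheory.Balaban1983to89
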